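import Literature.Probability.LatticeModels.KCSignContour
import HarnessLib

/-!
# The continuum configuration of the sign-condition argument

Topic `Literature/Probability/LatticeModels`. The data, fixed once in the continuum, from which
the per-scale contour of the lattice sign-condition argument (Chelkak–Smirnov 2012, proof of
Thm. 6.1 and Remark 6.3; `KCSignContour.lean`, `KCSignConditionLattice.lean`) is built at every
mesh: two base points `z₀ e` with the `ℓ¹`-distances `mInf e` to the complement of `Ω` (the
ends of the contour are the `ℓ¹`-nearest FROZEN sites to `z₀ e / δ`, `KCEndRun.lean`), a middle
(`M₁`, the flat piece `[q₁, q₂]` with normal direction `e_{km}` pointing to the seed side, `M₂`),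
a clear box about the middle of the flat piece, a seed point `zStar` near `∂Ω` with a Harnack
chain `w 0, …, w J` of bulk points leading to the far side of the half-boxes over the flat
piece, the two transport paths of the winding certificate (`Pz` from the seed to the seed side of
the flat piece, `Pw` from the other side into a bulk region `W` containing the exceptional set
`Bad` where subharmonicity is not available), and the separation inequalities between all these
pieces. `KCSignConfig Ω G Bad` packages them; `KCSignConditionContinuum.lean` derives the
contradiction from a configuration and lattice data, and `KCSignConfigExists.lean` constructs a
configuration near any boundary point of a Jordan domain.

Only definitions and elementary derived facts here (compactness of the auxiliary sets,
positivity of constants). All `[folklore]`; no named fact.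

## References

* D. Chelkak, S. Smirnov, Invent. Math. 189 (2012) = arXiv:0910.2045, proof of Thm. 6.1, Remark 6.3. [ChelkakSmirnov2012Ising]
* D. Chelkak, C. Hongler, K. Izyurov, Ann. of Math. 181 (2015), §3.3.1. [ChelkakHonglerIzyurovAnnals2015]
-/

noncomputable section

open Set Metric

namespace Literature.Probability.LatticeModels

open Site WeakBeurling

/-! ### Frame coordinates and constants -/

/-- The unit vector of lattice direction `k` as a complex number. [folklore] -/
def dirVec (k : Fin 4) : ℂ := toComplex (cornerUnit k)

/-- The coordinate of `w` along lattice direction `k` (dot product with `dirVec k`). [folklore] -/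
def dirCoord (k : Fin 4) (w : ℂ) : ℝ := w.re * (cornerUnit k 0 : ℝ) + w.im * (cornerUnit k 1 : ℝ)

/-- The closed sup-norm box of half-size `r` about `c`. [folklore] -/
def supBox (c : ℂ) (r : ℝ) : Set ℂ := {x | |(x - c).re| ≤ r ∧ |(x - c).im| ≤ r}

/-- Sup-norm boxes lie in Euclidean balls of twice the half-size. [folklore] -/
theorem supBox_subset_closedBall (c : ℂ) (r : ℝ) : supBox c r ⊆ closedBall c (2 * r) := by
  intro x hx
  rw [mem_closedBall, dist_eq_norm]
  refine (Complex.norm_le_abs_re_add_abs_im _).trans ?_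
  linarith [hx.1, hx.2]

/-- Euclidean balls lie in sup-norm boxes of the same radius. [folklore] -/
theorem closedBall_subset_supBox (c : ℂ) (r : ℝ) : closedBall c r ⊆ supBox c r := by
  intro x hx
  rw [mem_closedBall, dist_eq_norm] at hx
  exact ⟨(Complex.abs_re_le_norm _).trans hx, (Complex.abs_im_le_norm _).trans hx⟩

/-- Sup-norm boxes are compact. [folklore] -/
theorem isCompact_supBox (c : ℂ) (r : ℝ) : IsCompact (supBox c r) := by
  refine (isCompact_closedBall c (2 * r)).of_isClosed_subset ?_ (supBox_subset_closedBall c r)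
  have : supBox c r = (fun x : ℂ => |(x - c).re|) ⁻¹' Iic r ∩ (fun x : ℂ => |(x - c).im|) ⁻¹' Iic r := by
    ext x; simp [supBox]
  rw [this]
  exact (isClosed_Iic.preimage (by fun_prop)).inter (isClosed_Iic.preimage (by fun_prop))

/-- The seed-box ratio `Θ_R = 104 · (2C)^{1/β}` (so that `2C ((ρ+1)/(R+1))^β ≤ 1` for `ρ ≈ 103 κ/δ`,
`R ≈ Θ_R κ/δ`; `C, β` the weak-Beurling constants). [folklore] -/
def seedRatio : ℝ := 104 * (2 * beurlingConst) ^ (1 / beurlingExp)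

/-- The seed clearance multiplier `Θ_S = 3 Θ_R + 400`. [folklore] -/
def seedClear : ℝ := 3 * seedRatio + 400

/-- `Θ_R ≥ 104`. [folklore] -/
theorem seedRatio_ge : 104 ≤ seedRatio := by
  unfold seedRatio
  have h1 : (1 : ℝ) ≤ 2 * beurlingConst := by linarith [one_le_beurlingConst]
  have : (1 : ℝ) ≤ (2 * beurlingConst) ^ (1 / beurlingExp) :=
    Real.one_le_rpow h1 (div_nonneg zero_le_one beurlingExp_pos.le)
  linarith

/-- `Θ_S ≥ 712`. [folklore] -/
theorem seedClear_ge : 712 ≤ seedClear := by unfold seedClear; linarith [seedRatio_ge]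

/-! ### The configuration -/

/-- **The continuum configuration of the sign-condition argument** near a stretch of `∂Ω`
inside the open set `G` (where the limit is negative and the Kadanoff–Ceva bounds hold), away
from the exceptional bulk set `Bad`. See the module docstring for the meaning of the fields; all
lengths are in the units of `Ω` (the lattice objects at mesh `δ` are obtained by dividing by `δ`).
[cite: ChelkakSmirnov2012Ising, proof of Thm. 6.1 and Remark 6.3] -/
structure KCSignConfig (Ω G Bad : Set ℂ) where
  /-- base points of the two ends -/
  z₀ : Fin 2 → ℂ
  /-- `ℓ¹`-distance from `z₀ e` to the complement of `Ω` -/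
  mInf : Fin 2 → ℝ
  mInf_pos : ∀ e, 0 < mInf e
  diamond_subset : ∀ e, {w | l1norm (w - z₀ e) < mInf e} ⊆ Ω
  touch : ∀ e, ∃ p, p ∉ Ω ∧ l1norm (p - z₀ e) = mInf e
  /-- slack of the end zones `E e = {l1norm (· - z₀ e) ≤ mInf e + slack}` -/
  slack : ℝ
  slack_pos : 0 < slack
  endZone_subset : ∀ e, {w | l1norm (w - z₀ e) ≤ mInf e + 2 * slack} ⊆ G
  endZone_disjoint : ∀ w, l1norm (w - z₀ 0) ≤ mInf 0 + slack → mInf 1 + slack < l1norm (w - z₀ 1)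
  /-- normal direction of the flat piece, pointing to the seed side -/
  km : Fin 4
  /-- midpoint and half-length of the flat piece `[q₁, q₂] = pmid ∓ (len/2) e_{km+1}` -/
  pmid : ℂ
  len : ℝ
  len_pos : 0 < len
  /-- the rest of the middle -/
  M₁ : Path (z₀ 0) (pmid - ((len / 2 : ℝ) : ℂ) * dirVec (km + 1))
  M₂ : Path (pmid + ((len / 2 : ℝ) : ℂ) * dirVec (km + 1)) (z₀ 1)
  /-- thickening radius of the middle inside `Ω ∩ G` -/
  rM : ℝ
  rM_pos : 0 < rM
  mid_thick_subset : cthickening rM (range M₁ ∪ segment ℝ (pmid - ((len / 2 : ℝ) : ℂ) * dirVec (km + 1))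
    (pmid + ((len / 2 : ℝ) : ℂ) * dirVec (km + 1)) ∪ range M₂) ⊆ Ω ∩ G
  /-- half-size of the clear box about `pmid` -/
  ℓ : ℝ
  ℓ_pos : 0 < ℓ
  ℓ_le : ℓ ≤ len / 4
  clearBox_subset : {w | |dirCoord km (w - pmid)| ≤ 2 * ℓ ∧ |dirCoord (km + 1) (w - pmid)| ≤ 2 * ℓ} ⊆ Ω ∩ G
  clearBox_mid : ∀ w, |dirCoord km (w - pmid)| ≤ 2 * ℓ → |dirCoord (km + 1) (w - pmid)| ≤ 2 * ℓ → w ∉ range M₁ ∧ w ∉ range M₂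
  clearBox_end : ∀ w, |dirCoord km (w - pmid)| ≤ 2 * ℓ → |dirCoord (km + 1) (w - pmid)| ≤ 2 * ℓ →
    ∀ e, mInf e + slack < l1norm (w - z₀ e)
  /-- the seed point and the Harnack scale `κ` -/
  zStar : ℂ
  κ : ℝ
  κ_pos : 0 < κ
  κ_le : 400 * κ ≤ ℓ
  seed_near : ∃ q ∈ frontier Ω, dist q zStar ≤ 100 * κ ∧ q ∈ G
  seedBall_subset : closedBall zStar (seedClear * κ) ⊆ G
  seedBall_mid : ∀ w ∈ closedBall zStar (seedClear * κ), w ∉ range M₁ ∧ w ∉ range M₂ ∧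
    w ∉ segment ℝ (pmid - ((len / 2 : ℝ) : ℂ) * dirVec (km + 1)) (pmid + ((len / 2 : ℝ) : ℂ) * dirVec (km + 1))
  /-- the scale of the dead cemetery at the ends -/
  dR : ℝ
  dR_pos : 0 < dR
  far_end_seed : ∀ e w, l1norm (w - z₀ e) ≤ mInf e + slack → 2 * dR + seedClear * κ ≤ dist w zStar
  /-- the Harnack chain -/
  J : ℕ
  w : ℕ → ℂ
  w_zero : w 0 = zStar
  w_step : ∀ j, j < J → |(w (j + 1) - w j).re| ≤ 6 * κ ∧ |(w (j + 1) - w j).im| ≤ 6 * κ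
  window_subset : ∀ j, j ≤ J → supBox (w j) (50 * κ) ⊆ Ω ∩ G
  window_mid : ∀ j, j ≤ J → ∀ x ∈ supBox (w j) (50 * κ), x ∉ range M₁ ∧ x ∉ range M₂ ∧
    x ∉ segment ℝ (pmid - ((len / 2 : ℝ) : ℂ) * dirVec (km + 1)) (pmid + ((len / 2 : ℝ) : ℂ) * dirVec (km + 1))
  window_end : ∀ j, j ≤ J → ∀ x ∈ supBox (w j) (50 * κ), ∀ e, mInf e + slack < l1norm (x - z₀ e)
  /-- the far side of the half-boxes is covered by the chain: every point at normal coordinate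
  `65 κ` and tangential coordinate `≤ 200 κ` from `pmid` is within `10 κ` (both coordinates) of a chain point -/
  farside : ∀ t : ℝ, |t| ≤ 200 * κ → ∃ j, j ≤ J ∧
    |(w j - (pmid + ((65 * κ : ℝ) : ℂ) * dirVec km + (t : ℂ) * dirVec (km + 1))).re| ≤ 10 * κ ∧
    |(w j - (pmid + ((65 * κ : ℝ) : ℂ) * dirVec km + (t : ℂ) * dirVec (km + 1))).im| ≤ 10 * κ
  /-- the transport path from the seed to the seed side of the flat piece -/
  Pz : Path zStar (pmid + ((ℓ : ℝ) : ℂ) * dirVec km)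
  /-- the bulk region of the exceptional set and the transport path into it -/
  W : Set ℂ
  W_open : IsOpen W
  W_conn : IsPathConnected W
  W_bdd : Bornology.IsBounded W
  Bad_subset : Bad ⊆ W
  wW : ℂ
  wW_mem : wW ∈ W
  Pw : Path (pmid - ((ℓ : ℝ) : ℂ) * dirVec km) wW
  /-- clearance of the transport paths and of `W` -/
  d₀ : ℝ
  d₀_pos : 0 < d₀
  paths_thick_subset : cthickening d₀ (range Pz ∪ range Pw ∪ closure W) ⊆ Ω
  paths_mid : ∀ x ∈ range Pz ∪ range Pw ∪ closure W, x ∉ range M₁ ∧ x ∉ range M₂ ∧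
    x ∉ segment ℝ (pmid - ((len / 2 : ℝ) : ℂ) * dirVec (km + 1)) (pmid + ((len / 2 : ℝ) : ℂ) * dirVec (km + 1))
  paths_end : ∀ x ∈ range Pz ∪ range Pw ∪ closure W, ∀ e, mInf e + slack < l1norm (x - z₀ e)

namespace KCSignConfig

variable {Ω G Bad : Set ℂ} (cfg : KCSignConfig Ω G Bad)

/-- The endpoints of the flat piece. [folklore] -/
def q₁ : ℂ := cfg.pmid - ((cfg.len / 2 : ℝ) : ℂ) * dirVec (cfg.km + 1)

/-- The endpoints of the flat piece. [folklore] -/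
def q₂ : ℂ := cfg.pmid + ((cfg.len / 2 : ℝ) : ℂ) * dirVec (cfg.km + 1)

/-- The middle of the contour as a set. [folklore] -/
def Mset : Set ℂ := range cfg.M₁ ∪ segment ℝ cfg.q₁ cfg.q₂ ∪ range cfg.M₂

/-- The end zone of end `e`: the closed `ℓ¹`-diamond of radius `mInf e + slack`. [folklore] -/
def endZone (e : Fin 2) : Set ℂ := {w | l1norm (w - cfg.z₀ e) ≤ cfg.mInf e + cfg.slack}

/-- The point of the seed side of the flat piece reached by `Pz`, and its mirror image. [folklore] -/
def yPlus : ℂ := cfg.pmid + ((cfg.ℓ : ℝ) : ℂ) * dirVec cfg.km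

/-- The mirror point on the other side of the flat piece, start of `Pw`. [folklore] -/
def yMinus : ℂ := cfg.pmid - ((cfg.ℓ : ℝ) : ℂ) * dirVec cfg.km

/-- The compact set where `u ≤ 0` is required at end length `μ` ("`μ`-away from the ends"): the
closed sub-diamonds of radius `mInf e - μ/2` and the `rM`-thickening of the middle. [folklore] -/
def Kmid (μ : ℝ) : Set ℂ := (⋃ e : Fin 2, {w | l1norm (w - cfg.z₀ e) ≤ cfg.mInf e - μ / 2}) ∪ cthickening cfg.rM cfg.Mset

/-- The compact set where `u ≤ -η N` is required: the `rM`-thickening of the flat piece. [folklore] -/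
def Kflat : Set ℂ := cthickening cfg.rM (segment ℝ cfg.q₁ cfg.q₂)

/-- The compact subset of `Ω` all of whose sites must be free (bulk coverage) at end length `μ`. [folklore] -/
def Kbulk (μ : ℝ) : Set ℂ :=
  (⋃ j ∈ Finset.range (cfg.J + 1), supBox (cfg.w j) (50 * cfg.κ)) ∪
    {w | |dirCoord cfg.km (w - cfg.pmid)| ≤ 2 * cfg.ℓ ∧ |dirCoord (cfg.km + 1) (w - cfg.pmid)| ≤ 2 * cfg.ℓ} ∪
    cthickening (cfg.d₀ / 2) (range cfg.Pz ∪ range cfg.Pw ∪ closure cfg.W) ∪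
    cthickening (cfg.rM / 2) cfg.Mset ∪
    (⋃ e : Fin 2, {w | l1norm (w - cfg.z₀ e) ≤ cfg.mInf e - μ / 8})

end KCSignConfig

end Literature.Probability.LatticeModels
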